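import Summits.RiemannHypothesis.RiemannHypothesis.Theses.SpectralTrace
import Summits.RiemannHypothesis.RiemannHypothesis.Theorems.SpectralTraceWindowTraceArchStubBase
import Summits.RiemannHypothesis.RiemannHypothesis.Theorems.SpectralTraceWindowTraceArchStubAcuteAngle
import Summits.RiemannHypothesis.RiemannHypothesis.Theorems.SpectralTraceWindowTraceArchStubDomination
import Summits.RiemannHypothesis.RiemannHypothesis.Theorems.SpectralTraceWindowTraceArchStubCompactness
import Summits.RiemannHypothesis.RiemannHypothesis.Theorems.SpectralTraceWindowTraceArchStubDenseFamily
import Summits.RiemannHypothesis.RiemannHypothesis.Theorems.SpectralTraceWindowTraceArchStubExtensionOfDense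
import Summits.RiemannHypothesis.RiemannHypothesis.Theorems.SpectralTraceWindowTraceArchStubBandlimitedTest
import Summits.RiemannHypothesis.RiemannHypothesis.Theorems.SpectralTraceWindowTraceArchStubSelbergTests
import Summits.RiemannHypothesis.RiemannHypothesis.Theorems.SpectralTraceWindowTraceArchStubCountingLaw
import Summits.RiemannHypothesis.RiemannHypothesis.Theorems.SpectralTraceWindowTraceArchStubSortedEnumeration
import Summits.RiemannHypothesis.RiemannHypothesis.Theorems.SpectralTraceWindowTraceArchStubDisplacementBound
import Summits.RiemannHypothesis.RiemannHypothesis.Theorems.SpectralTraceWindowTraceArchStubStructureAssembly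
import HarnessLib

/-!
# RiemannHypothesis / SpectralTrace — crux `WindowTraceArch` ⟺ bounded-displacement designs of the França–LeClair lattice

Route `RiemannHypothesis/SpectralTrace`, crux item stmt-RiemannHypothesis-11195 (`WindowTraceArch`),
line `defect-compactness-design` (helper file, `--supports`, anchor stub `stub_designIffCrux`; lead).

**Statement (`stub_designIffCrux`).** The DESIGN STATEMENT of the line — for every injective enumeration `x`
of `FL = {t : 7 ≤ |t| ∧ cos θ t = 0}` there is ONE budget `D` such that every finite list of window Weil tests
(smooth, supported in `[-log 2, log 2]`) is reproduced EXACTLY (`HasSum` of `ĝⱼ(½ + i(x n + δ n))` to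
`W(gⱼ)`) by some displacement `|δ n| ≤ D`, given the acute-angle form of Brouwer's theorem — is EQUIVALENT to
the crux `Summit.RiemannHypothesis.RiemannHypothesis.Theses.SpectralTrace.WindowTraceArch`.

**Proof.** `→`: the six soft stubs of the line (all landed in this directory): enumerate `FL` (`stub_base`),
take designs for the prefixes of a dense family of window tests (`stub_denseFamily`), pass to the limit in
`[-D, D]^ℕ` (`stub_compactness`, dominated by `stub_domination`) and extend to every window test
(`stub_extensionOfDense`); the acute-angle hypothesis is the landed `stub_acuteAngle`. `←`: the structure
theorem (`stub_structureAssembly` fed with `stub_countingLaw stub_bandlimitedTest stub_selbergTests`,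
`stub_sortedEnumeration`, `stub_displacementBound`): every witness of the crux is a bounded displacement of
`FL`, so one displacement serves every list. Consequently the line's only open stub `stub_design` is not merely
crux-hard: it IS the crux (its hypothesis, the acute-angle lemma, being proved).
-/

set_option linter.dupNamespace false

noncomputable section

open Complex Filter Set MeasureTheory
open scoped Real Topology

namespace Summit.RiemannHypothesis.RiemannHypothesis.Theorems.SpectralTraceWindowTraceArch

open Literature.NumberTheory.LFunctions

/-- **`DesignStatement ↔ WindowTraceArch`** — the registered anchor stub `stub_designIffCrux` of the line
`defect-compactness-design`: bounded-displacement designs of the França–LeClair lattice for every finite test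
list, with one budget (given the acute-angle lemma), exist if and only if the archimedean rung holds. -/
theorem stub_designIffCrux :
    ((∀ (m : ℕ) (R : ℝ), 0 < R → ∀ f : (Fin m → ℝ) → (Fin m → ℝ), Continuous f → (∀ c : Fin m → ℝ, ∑ i, c i ^ 2 = R ^ 2 → 0 ≤ ∑ i, c i * f c i) → ∃ c : Fin m → ℝ, ∑ i, c i ^ 2 ≤ R ^ 2 ∧ f c = 0) → ∀ x : ℕ → ℝ, Function.Injective x → Set.range x = {t : ℝ | 7 ≤ |t| ∧ Real.cos (Literature.NumberTheory.LFunctions.riemannSiegelTheta t) = 0} → ∃ D : ℝ, ∀ (g : ℕ → ℝ → ℂ) (m : ℕ), (∀ j, Literature.NumberTheory.LFunctions.IsWeilTest (g j) ∧ tsupport (g j) ⊆ Set.Icc (-Real.log 2) (Real.log 2)) → ∃ δ : ℕ → ℝ, (∀ n, |δ n| ≤ D) ∧ ∀ j < m, HasSum (fun n => Literature.NumberTheory.LFunctions.weilMellin (g j) (1 / 2 + ((x n + δ n : ℝ) : ℂ) * Complex.I)) (Literature.NumberTheory.LFunctions.weilFunctional (g j))) ↔ Summit.RiemannHypothesis.RiemannHypothesis.Theses.SpectralTrace.WindowTraceArch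 := by
  constructor
  · -- designs ⇒ crux (the six soft stubs)
    intro hdesign
    obtain ⟨x, hxinj, hxrange, C, N, hprof⟩ := stub_base
    obtain ⟨D, hdes⟩ := hdesign stub_acuteAngle x hxinj hxrange
    obtain ⟨g, hg, hdense⟩ := stub_denseFamily
    choose δ hδD hδex using fun m => hdes g m hg
    have hev : ∀ j, ∀ᶠ k in atTop,
        HasSum (fun n => weilMellin (g j) (1 / 2 + ((x n + δ k n : ℝ) : ℂ) * I))
          (weilFunctional (g j)) := fun j =>
      Filter.eventually_atTop.2 ⟨j + 1, fun k hk => hδex k j (by omega)⟩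
    obtain ⟨δ', hδ'D, hδ'ex⟩ := stub_compactness stub_domination x C D N g δ hprof
      (fun j => (hg j).1) hδD hev
    exact ⟨ℕ, fun n => x n + δ' n, fun f hf hfs => stub_extensionOfDense stub_domination g ⟨hg, hdense⟩
      x C D N δ' hprof hδ'D hδ'ex f hf hfs⟩
  · -- crux ⇒ designs (the structure theorem)
    intro h _ x hxinj hxrange
    obtain ⟨ι, γ, hγ⟩ := h
    obtain ⟨D, δ, hδ, hw⟩ := stub_structureAssembly
      (stub_countingLaw stub_bandlimitedTest stub_selbergTests) stub_sortedEnumeration stub_displacementBound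
      ι γ hγ x hxinj hxrange
    exact ⟨D, fun g _ hg => ⟨δ, hδ, fun j _ => hw (g j) (hg j).1 (hg j).2⟩⟩

end Summit.RiemannHypothesis.RiemannHypothesis.Theorems.SpectralTraceWindowTraceArch

end
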